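import Summits.Ventures.PercRepro.PerFlatHall
import Summits.Ventures.PercRepro.GenQRuleA

/-!
# PercRepro — the hard max-trace rule is a per-flat certificate supported on adjacency: its per-flat inequalities
imply the Hall condition (night-4, gen 2)

`GenQRuleA.lean` charges the rank-`q` flats through the hard max-trace rule `fHardQ` (weight `1` to a flat `P` when
the trace `S ∩ P` has rank `q` and maximal size), normalised by `DHardQ`.  The rule vanishes off adjacency
(`fHardQ_eq_zero_of_not_adj`), so whenever its per-flat inequalities hold on a matroid `M` the weighting
`fHardQ / DHardQ` is a certificate in the sense of `PerFlatHall.lean` (`isCert_hardRule`) and the Hall condition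
`Hall M (q + 2) q c` holds on `M` (`hall_of_hardRule`).  Contrapositive: a matroid on which the Hall condition fails
(a max-flow computation) is a matroid on which the hard max-trace rule — and every other rule supported on
adjacency — cannot prove the row `(q + 2, q)`.  Imports: `PerFlatHall` and `GenQRuleA`.
-/

namespace PercRepro.GenQ

open Finset ThmH PerFlat

variable {α : Type*} [DecidableEq α] {M : Matroid α} [M.Finite]

/-- The hard max-trace rule vanishes off adjacency. -/
theorem fHardQ_eq_zero_of_not_adj {q : ℕ} {G S : Finset α} (h : ¬ Adj M q G S) : fHardQ M q G S = 0 := by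
  unfold fHardQ
  rw [if_neg]
  intro hc
  exact h hc.1

/-- The normalised hard max-trace rule is a certificate as soon as its per-flat inequalities hold. -/
theorem isCert_hardRule {q : ℕ} {c : ℚ}
    (hflat : ∀ G ∈ flatsQ M q, c * ((UqG M (q + 2) q G).card : ℚ) ≤
      ∑ S ∈ Yq M (q + 2) q, fHardQ M q G S / DHardQ M q S) :
    IsCert M (q + 2) q c (fun G S => fHardQ M q G S / DHardQ M q S) where
  nonneg := fun G S => div_nonneg (fHardQ_nonneg q G S) (DHardQ_nonneg q S)
  support := fun G _ S h => by rw [fHardQ_eq_zero_of_not_adj h, zero_div]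
  sum_le_one := fun S _ => sum_normalized_le_one q (fHardQ M q) (fun G S => fHardQ_nonneg q G S) S
  perFlat := hflat

/-- **The per-flat inequalities of the hard max-trace rule imply the Hall condition.** -/
theorem hall_of_hardRule {q : ℕ} {c : ℚ} (hc : 0 ≤ c)
    (hflat : ∀ G ∈ flatsQ M q, c * ((UqG M (q + 2) q G).card : ℚ) ≤
      ∑ S ∈ Yq M (q + 2) q, fHardQ M q G S / DHardQ M q S) :
    Hall M (q + 2) q c :=
  hall_of_cert hc (isCert_hardRule hflat)

end PercRepro.GenQ
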